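import Mathlib
import HarnessLib
import Summits.AnomalousDissipation.AnomalousDissipation.Theses.LimitingAbsorption
import Summits.AnomalousDissipation.AnomalousDissipation.Theorems.RelaxingFamily.Negative.LinearEnstrophyBudget
import Summits.AnomalousDissipation.AnomalousDissipation.Theorems.RelaxingFamily.Negative.SublogBudget

/-!
# Strategist sketch — crux `LimitingAbsorption.RelaxingFamily` (stmt-AnomalousDissipation-15009)

Typed objects for the four lenses of `STRATEGY-CENSUS.md` (crux-strategist seat
planner-cstrat-stmt-AnomalousDissipation-15009-p1-0, 2026-08-17). Everything here ELABORATES; the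
few theorems are bookkeeping glue proved sorry-free; `def … : Prop` objects named `…Target` /
`…Law` are NOT claimed — they are the typed residues the census discusses.

* §T transfer   — `KinematicRelaxingFamily` (the solved sibling's statement: crux minus the
                   Navier–Stokes clause), `relaxingFamily_iff_kinematic_realised` (the break point,
                   typed: the NS-realisation clause is the whole difference).
* §S strengthen — `PeriodicStates`, `SteadyStates`, `AllData` as `RelaxingFamilyUnder`-classes, the
                   one-line implications `S⁺ → crux`, and the typed negative target `allData_noGoTarget`.
* §D decompose  — `MixesAllDataAtRate` (pure-transport exponential mixing, κ = 0, all smooth data),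
                   `LogRateMixingStates` (Sub₁: NS side), `MixingToRelaxation` (Sub₂: kinematic
                   Feng–Iyer / Coti Zelati–Delgadino–Elgindi upgrade with explicit uniformity),
                   `relaxingFamily_of_split` (glue, PROVED).
* §N negation   — `SublogStrainLaw` (the missing universal lemma) and
                   `not_relaxingFamily_of_sublogStrainLaw` (glue, PROVED from the landed
                   `relaxingFamily_false_without_logEnstrophy`).
-/

noncomputable section

open MeasureTheory Set Filter Topology Function

namespace Summit.AnomalousDissipation.AnomalousDissipation.Cruxes.RelaxingFamily.Strategist

set_option linter.dupNamespace false
set_option linter.unusedVariables false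

open Literature.Analysis.FunctionSpaces Literature.Analysis.FunctionSpaces.Torus
open Literature.Analysis.FluidPDE Literature.Analysis.FluidPDE.Torus
open Summit.AnomalousDissipation.AnomalousDissipation.Theses.LimitingAbsorption
open Summit.AnomalousDissipation.AnomalousDissipation.Theorems.RelaxingFamily.Negative

/-- The unit flat 2-torus (local notation). -/
local notation "𝕋²" => UnitAddTorus (Fin 2)
/-- Planar vectors (local notation). -/
local notation "E²" => EuclideanSpace ℝ (Fin 2)

/-- The hypothesis-class shape of `RelaxingFamilyUnder`. -/
abbrev Hyp : Type := (𝕋² → E²) → (𝕋² → ℝ) → (ℕ → ℝ) → (ℕ → ℝ → 𝕋² → E²) → Prop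

/-! ## §T  Transfer: the solved sibling's statement and the exact break point -/

/-- **The kinematic sibling of the crux** (what Hess-Childs–Rowan 2025b Cor. 1.2 / Armstrong–Vicol /
Elgindi–Liss deliver in kind): the crux with the Navier–Stokes clause
`IsGlobalLerayHopf (ν j) (fun _ => g) (v₀ j) (v j)` replaced by the bare side conditions a scalar
problem needs — weakly divergence-free slices, local boundedness, bounded mean energy. No force,
no fluid equation. -/
def KinematicRelaxingFamily : Prop :=
  ∃ (h : 𝕋² → ℝ), IsSmooth h ∧ HasZeroMean h ∧ h ≠ 0 ∧
    ∃ (ν : ℕ → ℝ) (v : ℕ → ℝ → 𝕋² → E²),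
      (∀ j, 0 < ν j) ∧ Tendsto ν atTop (𝓝 0) ∧
      (∀ j t, IsWeaklyDivFree (v j t)) ∧
      (∀ j (T : ℝ), 0 < T → MemLp (stLift (v j)) ⊤ (volume.restrict (Ioo (0 : ℝ) T ×ˢ univ))) ∧
      (∃ E : ℝ, ∀ j, meanEnergy (v j) ≤ E) ∧
      ∃ C γ : ℝ, 0 ≤ C ∧ 0 < γ ∧ RelaxesUniformly ν v h C γ

/-- **NS-realisation of a kinematic family by ONE steady force**: the clause the transfer must add. -/
def SteadilyRealised (ν : ℕ → ℝ) (v : ℕ → ℝ → 𝕋² → E²) : Prop :=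
  ∃ (g : 𝕋² → E²) (v₀ : ℕ → 𝕋² → E²), IsSmooth g ∧ IsDivFree g ∧ HasZeroMean g ∧
    ∀ j, IsGlobalLerayHopf (ν j) (fun _ => g) (v₀ j) (v j)

/-- The kinematic sibling WITH the realisation clause on the same family. -/
def KinematicRelaxingFamilyRealised : Prop :=
  ∃ (h : 𝕋² → ℝ), IsSmooth h ∧ HasZeroMean h ∧ h ≠ 0 ∧
    ∃ (ν : ℕ → ℝ) (v : ℕ → ℝ → 𝕋² → E²),
      (∀ j, 0 < ν j) ∧ Tendsto ν atTop (𝓝 0) ∧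
      SteadilyRealised ν v ∧
      (∀ j (T : ℝ), 0 < T → MemLp (stLift (v j)) ⊤ (volume.restrict (Ioo (0 : ℝ) T ×ˢ univ))) ∧
      (∃ E : ℝ, ∀ j, meanEnergy (v j) ≤ E) ∧
      ∃ C γ : ℝ, 0 ≤ C ∧ 0 < γ ∧ RelaxesUniformly ν v h C γ

/-- **Break point, typed.** The crux is EXACTLY "kinematic sibling + steady NS realisation of the same
family": the transfer from the solved passive-scalar side succeeds iff its fields can be chosen to be
Leray–Hopf solutions for one steady smooth force along `ν_j → 0`. (Bookkeeping; both directions are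
re-orderings of the existential block.) -/
theorem relaxingFamily_iff_kinematic_realised :
    RelaxingFamily ↔ KinematicRelaxingFamilyRealised := by
  constructor
  · rintro ⟨g, h, hg, hgd, hgm, hh, hhm, hh0, ν, v₀, v, hν, hνlim, hLH, hbd, hE, C, γ, hC, hγ, hrel⟩
    exact ⟨h, hh, hhm, hh0, ν, v, hν, hνlim, ⟨g, v₀, hg, hgd, hgm, hLH⟩, hbd, hE, C, γ, hC, hγ,
      fun j s hs T θ hθ => hrel j s hs T θ hθ⟩
  · rintro ⟨h, hh, hhm, hh0, ν, v, hν, hνlim, ⟨g, v₀, hg, hgd, hgm, hLH⟩, hbd, hE, C, γ, hC, hγ, hrel⟩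
    exact ⟨g, h, hg, hgd, hgm, hh, hhm, hh0, ν, v₀, v, hν, hνlim, hLH, hbd, hE, C, γ, hC, hγ,
      fun j s hs T θ hθ => hrel j s hs T θ hθ⟩

/-! ## §S  Strengthen: three rigid forms `S⁺ = RelaxingFamilyUnder <class>` and what each buys -/

/-- S⁺₁ class: exact time-periodic states with a `j`-uniform period cap (UPO / recurrent form; the
phase quantifier collapses to one period — in tree for the sister crux:
`Theorems/LimitingAbsorptionUniformRelaxationWitnessPeriodicTransfer.lean`). -/
def PeriodicStates : Hyp := fun _g _h _ν v =>
  ∃ (T : ℕ → ℝ) (T₀ : ℝ), ∀ j, 0 < T j ∧ T j ≤ T₀ ∧ Function.Periodic (v j) (T j)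

/-- S⁺₂ class: steady states (autonomous scalar problem; phase quantifier vacuous). -/
def SteadyStates : Hyp := fun _g _h _ν v => ∀ j t, 0 ≤ t → v j t = v j 0

/-- S⁺₃ class: the family relaxes ALL smooth mean-zero profiles with one `(C, γ)` (uniform
exponential stability of the scalar propagator on `L²₀`; Datko–Pazy / Gearhart–Prüss form). -/
def AllData : Hyp := fun _g _h ν v =>
  ∃ C γ : ℝ, 0 ≤ C ∧ 0 < γ ∧ ∀ h' : 𝕋² → ℝ, IsSmooth h' → HasZeroMean h' → RelaxesUniformly ν v h' C γ

/-- Each strengthening implies the crux (one line: drop the extra structure). -/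
theorem relaxingFamily_of_periodicStates (hS : RelaxingFamilyUnder PeriodicStates) : RelaxingFamily :=
  hS.relaxingFamily

theorem relaxingFamily_of_steadyStates (hS : RelaxingFamilyUnder SteadyStates) : RelaxingFamily :=
  hS.relaxingFamily

theorem relaxingFamily_of_allData (hS : RelaxingFamilyUnder AllData) : RelaxingFamily :=
  hS.relaxingFamily

/-- Steady states are periodic states of every period (so S⁺₂ ⊂ S⁺₁ up to the cap): recorded to show
the two rigid forms nest. -/
theorem periodicStates_of_steadyStates {g : 𝕋² → E²} {h : 𝕋² → ℝ} {ν : ℕ → ℝ}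
    {v : ℕ → ℝ → 𝕋² → E²} (hst : ∀ j t, v j t = v j 0) : PeriodicStates g h ν v :=
  ⟨fun _ => 1, 1, fun j => ⟨one_pos, le_rfl, fun t => by rw [hst j (t + 1), hst j t]⟩⟩

/-- **Typed negative target for S⁺₃ (the Prandtl-one passenger; NOT claimed here).** A family relaxing
ALL smooth data uniformly relaxes `curl g`, hence has `j`-uniformly bounded late enstrophy (Duhamel for
the vorticity equation, which is the crux's own scalar equation sourced by `curl g`), hence is excluded
by the landed `relaxingFamily_false_without_unboundedEnstrophy`. Missing tree input: the weak VORTICITY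
formulation of planar Leray–Hopf solutions (`Disproof.lean` N2). -/
def allData_noGoTarget : Prop := ¬ RelaxingFamilyUnder AllData

/-! ## §D  Decomposition: Sub₁ (NS-generated log-rate mixing) + Sub₂ (kinematic upgrade) → crux -/

/-- `H¹`-size of a profile: `(‖f‖²_{L²} + ‖∇f‖²_{L²})^{1/2}` (spectral gradient norm, junk-safe). -/
def h1Size (f : 𝕋² → ℝ) : ℝ := Real.sqrt (scalarL2Sq f + (eScalarGradNormSq f).toReal)

/-- **Pure-transport exponential mixing at rate `λ` with cost `D`, all smooth mean-zero data**:
every weak solution of `∂ₜθ + u·∇θ = 0` (`κ = 0`) from a smooth mean-zero datum decorrelates from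
every smooth mean-zero observable at rate `λ`, measured in `H¹ × H¹` (the `H^{-1}`-mixing scale of
Feng–Iyer 2019 / Coti Zelati–Delgadino–Elgindi 2020, written without an `H^{-1}` norm). -/
def MixesAllDataAtRate (u : ℝ → 𝕋² → E²) (lam D : ℝ) : Prop :=
  ∀ θ₀ : 𝕋² → ℝ, IsSmooth θ₀ → HasZeroMean θ₀ →
    ∀ (T : ℝ) (θ : ℝ → 𝕋² → ℝ), IsWeakScalarTransportOn T 0 u θ₀ θ →
      ∀ φ : 𝕋² → ℝ, IsSmooth φ → HasZeroMean φ →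
        ∀ᵐ t ∂(volume.restrict (Ioo (0 : ℝ) T)),
          |∫ x, θ t x * φ x| ≤ D * Real.exp (-(lam * t)) * h1Size θ₀ * h1Size φ

/-- **Sub₁ (NS side, scalar-DIFFUSION-free): log-rate mixing states.** A bounded-energy, locally bounded,
steadily forced planar Leray–Hopf family along `ν_j → 0` whose Lagrangian flows mix ALL smooth data, from
EVERY phase, at rate `≥ c·log(1/ν_j)` with one cost constant `D`, with gradients at most polynomial in
`1/ν_j` (slice-wise Lipschitz constant `≤ ν_j^{-m}`). -/
def LogRateMixingStates : Prop :=
  ∃ (g : 𝕋² → E²) (h : 𝕋² → ℝ), IsSmooth g ∧ IsDivFree g ∧ HasZeroMean g ∧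
    IsSmooth h ∧ HasZeroMean h ∧ h ≠ 0 ∧
    ∃ (ν : ℕ → ℝ) (v₀ : ℕ → 𝕋² → E²) (v : ℕ → ℝ → 𝕋² → E²),
      (∀ j, 0 < ν j ∧ ν j < 2⁻¹) ∧ Tendsto ν atTop (𝓝 0) ∧
      (∀ j, IsGlobalLerayHopf (ν j) (fun _ => g) (v₀ j) (v j)) ∧
      (∀ j (T : ℝ), 0 < T → MemLp (stLift (v j)) ⊤ (volume.restrict (Ioo (0 : ℝ) T ×ˢ univ))) ∧
      (∃ E : ℝ, ∀ j, meanEnergy (v j) ≤ E) ∧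
      ∃ (c D : ℝ) (m : ℕ), 0 < c ∧ 0 ≤ D ∧
        (∀ j (s : ℝ), 0 ≤ s → MixesAllDataAtRate (fun t => v j (s + t)) (c * Real.log (ν j)⁻¹) D) ∧
        (∀ j t, 0 ≤ t → LipschitzWith (Real.toNNReal ((ν j)⁻¹ ^ m)) (v j t))

/-- **Sub₂ (kinematic, NS-free): mixing at rate `c·log(1/ν)` + polynomial gradients ⇒ ν-uniform,
phase-uniform exponential `L²` relaxation of every smooth profile.** The uniform-in-family form of the
"mixing ⇒ enhanced dissipation" theorems (Feng–Iyer 2019; Coti Zelati–Delgadino–Elgindi 2020,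
dissipation times from mixing rates): IF the dissipation time were `≲ (1/λ_j) log(Lip_j/ν_j) ≍ (m+1)/c`
it would be `j`-independent. STATUS (census §4 D-a(2)): with rate exponent 1, as typed, this SHARP form is
open in general — the general theorems give `≲ |log κ|²/λ`, log-sharpness being known only for special drifts
(Elgindi–Liss–Mattingly 2023; stochastic NS almost surely); independent of Navier–Stokes either way. -/
def MixingToRelaxation : Prop :=
  ∀ (c D : ℝ) (m : ℕ), 0 < c → 0 ≤ D →
    ∃ C γ : ℝ, 0 ≤ C ∧ 0 < γ ∧
      ∀ (ν : ℕ → ℝ) (u : ℕ → ℝ → 𝕋² → E²),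
        (∀ j, 0 < ν j ∧ ν j < 2⁻¹) →
        (∀ j (T : ℝ), 0 < T → MemLp (stLift (u j)) ⊤ (volume.restrict (Ioo (0 : ℝ) T ×ˢ univ))) →
        (∀ j t, 0 ≤ t → IsWeaklyDivFree (u j t)) →
        (∀ j (s : ℝ), 0 ≤ s → MixesAllDataAtRate (fun t => u j (s + t)) (c * Real.log (ν j)⁻¹) D) →
        (∀ j t, 0 ≤ t → LipschitzWith (Real.toNNReal ((ν j)⁻¹ ^ m)) (u j t)) →
        ∀ h : 𝕋² → ℝ, IsSmooth h → HasZeroMean h → RelaxesUniformly ν u h C γ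

/-- Leray–Hopf slices are weakly divergence-free for `t ≥ 0` — the one NS fact the glue consumes, kept
as an explicit hypothesis `LHDivFree` so that the split theorem is pure logic (it is a field of the
weak NS solution structure; no tree lemma packages it at every `t ≥ 0` for the global class). -/
def LHDivFree : Prop :=
  ∀ (κ : ℝ) (g : 𝕋² → E²) (v₀ : 𝕋² → E²) (v : ℝ → 𝕋² → E²),
    IsGlobalLerayHopf κ (fun _ => g) v₀ v → ∀ t, 0 ≤ t → IsWeaklyDivFree (v t)

/-- **The split, glued (PROVED): Sub₁ → Sub₂ → crux** (modulo the packaging fact `LHDivFree`). -/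
theorem relaxingFamily_of_split (hdiv : LHDivFree) (h₁ : LogRateMixingStates)
    (h₂ : MixingToRelaxation) : RelaxingFamily := by
  obtain ⟨g, h, hg, hgd, hgm, hh, hhm, hh0, ν, v₀, v, hν, hνlim, hLH, hbd, hE, c, D, m, hc, hD,
    hmix, hlip⟩ := h₁
  obtain ⟨C, γ, hC, hγ, hupgrade⟩ := h₂ c D m hc hD
  refine ⟨g, h, hg, hgd, hgm, hh, hhm, hh0, ν, v₀, v, fun j => (hν j).1, hνlim, hLH, hbd, hE, C, γ,
    hC, hγ, ?_⟩
  have hdv : ∀ j t, 0 ≤ t → IsWeaklyDivFree (v j t) := fun j t ht => hdiv _ _ _ _ (hLH j) t ht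
  exact hupgrade ν v hν hbd hdv hmix hlip h hh hhm

/-! ## §N  Negation: the missing universal lemma and the glue that would close the refutation -/

/-- **The sub-logarithmic strain law (MISSING; Kraichnan–Batchelor phenomenology `Z ~ log^{2/3}`
predicts it, only `⟨‖∇v‖²⟩ ≲ ν^{-1/2}` is proved — Alexakis–Doering 2006):** every bounded-energy,
locally bounded, steadily forced planar Leray–Hopf family along `ν_j → 0` has, at every level, a phase
after which the homogeneous windowed budget of `‖∇v_j‖_{L²}` has slope `M_j = o(log(1/ν_j))` — i.e. lies
in the landed excluded class `SublogEnstrophyBudget`. -/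
def SublogStrainLaw : Prop :=
  ∀ (g : 𝕋² → E²) (h : 𝕋² → ℝ) (ν : ℕ → ℝ) (v₀ : ℕ → 𝕋² → E²) (v : ℕ → ℝ → 𝕋² → E²),
    IsSmooth g → IsDivFree g → HasZeroMean g →
    (∀ j, 0 < ν j) → Tendsto ν atTop (𝓝 0) →
    (∀ j, IsGlobalLerayHopf (ν j) (fun _ => g) (v₀ j) (v j)) →
    (∀ j (T : ℝ), 0 < T → MemLp (stLift (v j)) ⊤ (volume.restrict (Ioo (0 : ℝ) T ×ˢ univ))) →
    (∃ E : ℝ, ∀ j, meanEnergy (v j) ≤ E) →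
    SublogEnstrophyBudget g h ν v

/-- **Negation glue (PROVED): the law would refute the crux** — by the landed quantitative Seis floor
`relaxingFamily_false_without_logEnstrophy`. So `¬RelaxingFamily` is EXACTLY as far away as the law. -/
theorem not_relaxingFamily_of_sublogStrainLaw (hlaw : SublogStrainLaw) : ¬ RelaxingFamily := by
  rintro ⟨g, h, hg, hgd, hgm, hh, hhm, hh0, ν, v₀, v, hν, hνlim, hLH, hbd, hE, C, γ, hC, hγ, hrel⟩
  refine relaxingFamily_false_without_logEnstrophy
    ⟨g, h, hg, hgd, hgm, hh, hhm, hh0, ν, v₀, v, hν, hνlim, hLH, hbd, hE,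
      hlaw g h ν v₀ v hg hgd hgm hν hνlim hLH hbd hE, C, γ, hC, hγ, ?_⟩
  exact fun j s hs T θ hθ => hrel j s hs T θ hθ

end Summit.AnomalousDissipation.AnomalousDissipation.Cruxes.RelaxingFamily.Strategist

end
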